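import Summits.Ventures.PercRepro.SixFourResidueFourGenericTable

/-!
# PercRepro — C-025 at `(6,4)`: the TW-100 table at `t = 4` — definitions and transfer (p3, gen 11 — §21.18.7)

Lemma TW (mine-2's §21.18.7) bounds `J₄` of a plane-line solid termwise by `T⁺(g,q) := C(q,2)·min_{2 ≤ m < q} L(g,q,m)/C(m,2)
− base(g,q)` (`Lterm4` / `base4` of `SixFourResidueFourGenericA.lean`, no partner term): `J₄ ≥ T⁺(g,p) + Σ_j w′_j` with
`w′_j = T⁺(g, n + s_j) − (12/5)·2^{s_j} − (48/5)·n − (12/5)·2^{n+e}·[j = j*]`.  THEOREM TW-100: for `13 ≤ g ≤ 100`, every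
`n ≥ 3`, `e ∈ {0,1}` and class size `1 + e ≤ s ≤ p − 3` (`p = g − n`), `w′ ≥ 0` with the pair charge on every class with
`2s ≥ p + e`, and `T⁺(g,p) > 0`.  This file makes it a finite check: the minimiser `m*(g,q)` (`mstar`: `q − 1` except eight
small cells), the integer minimiser check `MinCheck g q m` (`C(m*,2)·L(m) ≥ C(m,2)·L(m*)`, ×`15·(g − m)(g − m*)C(g,2)`), the
integer cell check `TWCell g n e s`, and the transfer lemmas to the rational forms (`mu_mul_le_of_minCheck`,
`tw_of_twCell`).  The per-`g` decides are in `SixFourResidueFourPlaneLineTW{A,B,C}.lean`.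
-/

namespace PercRepro.SixFour

/-- The minimiser `m*(g,q)` of `L(g,q,m)/C(m,2)` over `2 ≤ m < q` (exact for `10 ≤ g ≤ 100`, `3 ≤ q ≤ g − 3`): `q − 1`
except the eight listed cells. -/
def mstar (g q : ℕ) : ℕ :=
  if (g = 10 ∧ (q = 6 ∨ q = 7)) ∨ (g = 11 ∧ (q = 7 ∨ q = 8)) ∨ (g = 12 ∧ q = 9) ∨ (g = 13 ∧ q = 10) then 2
  else if g = 14 ∧ q = 11 then 3 else if g = 15 ∧ q = 12 then 5 else q - 1

/-- `2 ≤ m*(g,q) < q` for `3 ≤ q`. -/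
theorem mstar_bounds {g q : ℕ} (hq : 3 ≤ q) : 2 ≤ mstar g q ∧ mstar g q < q := by
  unfold mstar
  split_ifs <;> omega

/-- `μ(g,q) := L(g,q,m*)/C(m*,2)`, the minimum of `L(g,q,m)/C(m,2)`. -/
noncomputable def muTW (g q : ℕ) : ℚ := Lterm4 g q (mstar g q) / ((mstar g q).choose 2 : ℚ)

/-- `T⁺(g,q) = μ(g,q)·C(q,2) − base(g,q)`. -/
noncomputable def Tplus4 (g q : ℕ) : ℚ := muTW g q * (q.choose 2 : ℚ) - base4 g q

/-- The minimiser check, integer form: `C(m*,2)·LtermN4(m)·(g − m*) ≥ C(m,2)·LtermN4(m*)·(g − m)`. -/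
def MinCheck (g q m : ℕ) : Prop :=
  (m.choose 2 : ℤ) * LtermN4 g q (mstar g q) * ((g - m : ℕ) : ℤ) ≤
    ((mstar g q).choose 2 : ℤ) * LtermN4 g q m * ((g - mstar g q : ℕ) : ℤ)

/-- `MinCheck` is decidable. -/
instance (g q m : ℕ) : Decidable (MinCheck g q m) := by unfold MinCheck; infer_instance

/-- The pair charge of Lemma TW: `(12/5)·2^{n+e}` on a class with `2s ≥ p + e`, else `0`. -/
def chargeN (g n e s : ℕ) : ℤ := if g - n + e ≤ 2 * s then 36 * (2 ^ (n + e) : ℤ) else 0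

/-- The cell check of TW-100, integer form (×`15·(g − m*)·C(g,2)·C(m*,2)`):
`C(q,2)·LtermN4(m*) ≥ (g − m*)·C(g,2)·C(m*,2)·[3·base4N(q) + 36·2^s + 144·n + charge]`, `q = n + s`. -/
def TWCell (g n e s : ℕ) : Prop :=
  ((g - mstar g (n + s) : ℕ) : ℤ) * (g.choose 2 : ℤ) * ((mstar g (n + s)).choose 2 : ℤ) *
      (3 * base4N g (n + s) + 36 * (2 ^ s : ℤ) + 144 * (n : ℤ) + chargeN g n e s) ≤
    ((n + s).choose 2 : ℤ) * LtermN4 g (n + s) (mstar g (n + s))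

/-- `TWCell` is decidable. -/
instance (g n e s : ℕ) : Decidable (TWCell g n e s) := by unfold TWCell; infer_instance

/-- The `P₀`-term check: `T⁺(g,p) > 0`, integer form: `C(p,2)·LtermN4(m*) > (g − m*)·C(g,2)·C(m*,2)·3·base4N(p)`. -/
def TPosCell (g p : ℕ) : Prop :=
  ((g - mstar g p : ℕ) : ℤ) * (g.choose 2 : ℤ) * ((mstar g p).choose 2 : ℤ) * (3 * base4N g p) <
    (p.choose 2 : ℤ) * LtermN4 g p (mstar g p)

/-- `TPosCell` is decidable. -/
instance (g p : ℕ) : Decidable (TPosCell g p) := by unfold TPosCell; infer_instance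

/-- The check at a fixed `g`: `MinCheck g q m` for every `3 ≤ q ≤ g − 3`, `2 ≤ m < q`, and `TPosCell g q` for every
`4 ≤ q ≤ g − 3`. -/
def minCheckAll (g : ℕ) : Prop :=
  (∀ q < g, ∀ m < q, (!decide (3 ≤ q ∧ q + 3 ≤ g ∧ 2 ≤ m) || decide (MinCheck g q m)) = true) ∧
    (∀ q < g, (!decide (4 ≤ q ∧ q + 3 ≤ g) || decide (TPosCell g q)) = true)

/-- The check at a fixed `g`: `TWCell g n e s` for every `n ≥ 3`, `e ≤ 1`, `1 + e ≤ s ≤ g − n − 3`. -/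
def twCheckAll (g : ℕ) : Prop := ∀ n < g, ∀ e < 2, ∀ s < g,
  (!decide (3 ≤ n ∧ 1 + e ≤ s ∧ n + s + 3 ≤ g) || decide (TWCell g n e s)) = true

/-! ## Transfer to the rational forms -/

/-- From `MinCheck`: `μ(g,q)·C(m,2) ≤ L(g,q,m)` (for `2 ≤ g`, `m < g`, `3 ≤ q`, `q ≤ g`). -/
theorem mu_mul_le_of_minCheck {g q m : ℕ} (hg : 2 ≤ g) (hq : 3 ≤ q) (hqg : q ≤ g) (hm : m < g)
    (h : MinCheck g q m) : muTW g q * (m.choose 2 : ℚ) ≤ Lterm4 g q m := by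
  obtain ⟨hms2, hmsq⟩ := mstar_bounds (g := g) hq
  have hmsg : mstar g q < g := by omega
  unfold MinCheck at h
  unfold muTW
  have hQ : ((m.choose 2 : ℤ) * LtermN4 g q (mstar g q) * ((g - m : ℕ) : ℤ) : ℚ) ≤
      (((mstar g q).choose 2 : ℤ) * LtermN4 g q m * ((g - mstar g q : ℕ) : ℤ) : ℚ) := by exact_mod_cast h
  push_cast at hQ
  rw [LtermN4_eq hmsg hg, LtermN4_eq hm hg] at hQ
  have hD : (0 : ℚ) < ((g - m : ℕ) : ℚ) := by
    have : 0 < g - m := by omega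
    exact_mod_cast this
  have hD' : (0 : ℚ) < ((g - mstar g q : ℕ) : ℚ) := by
    have : 0 < g - mstar g q := by omega
    exact_mod_cast this
  have hC : (0 : ℚ) < (g.choose 2 : ℚ) := by
    have : 0 < g.choose 2 := Nat.choose_pos hg
    exact_mod_cast this
  have hCm : (0 : ℚ) < ((mstar g q).choose 2 : ℚ) := by
    have : 0 < (mstar g q).choose 2 := Nat.choose_pos hms2
    exact_mod_cast this
  have hmu : Lterm4 g q (mstar g q) / ((mstar g q).choose 2 : ℚ) * (m.choose 2 : ℚ) =
      Lterm4 g q (mstar g q) * (m.choose 2 : ℚ) / ((mstar g q).choose 2 : ℚ) := by ring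
  rw [hmu, div_le_iff₀ hCm]
  have hpos : (0 : ℚ) < 15 * ((g - m : ℕ) : ℚ) * (g.choose 2 : ℚ) * ((g - mstar g q : ℕ) : ℚ) := by positivity
  nlinarith [hQ, hpos]

/-- From `TWCell`: the rational cell inequality `(12/5)·2^s + (48/5)·n + charge ≤ T⁺(g, n + s)`. -/
theorem tw_of_twCell {g n e s : ℕ} (hg : 2 ≤ g) (hn : 3 ≤ n) (hs : 1 ≤ s) (hq : n + s ≤ g)
    (h : TWCell g n e s) :
    12 / 5 * (2 : ℚ) ^ s + 48 / 5 * (n : ℚ) + (if g - n + e ≤ 2 * s then 12 / 5 * (2 : ℚ) ^ (n + e) else 0) ≤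
      Tplus4 g (n + s) := by
  obtain ⟨hms2, hmsq⟩ := mstar_bounds (g := g) (q := n + s) (by omega)
  have hmsg : mstar g (n + s) < g := by omega
  unfold TWCell at h
  unfold Tplus4 muTW
  have hQ : (((g - mstar g (n + s) : ℕ) : ℤ) * (g.choose 2 : ℤ) * ((mstar g (n + s)).choose 2 : ℤ) *
      (3 * base4N g (n + s) + 36 * (2 ^ s : ℤ) + 144 * (n : ℤ) + chargeN g n e s) : ℚ) ≤
      (((n + s).choose 2 : ℤ) * LtermN4 g (n + s) (mstar g (n + s)) : ℚ) := by exact_mod_cast h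
  have hch : (chargeN g n e s : ℚ) = if g - n + e ≤ 2 * s then 36 * (2 : ℚ) ^ (n + e) else 0 := by
    unfold chargeN
    split_ifs <;> push_cast <;> ring
  push_cast at hQ
  rw [hch, LtermN4_eq hmsg hg] at hQ
  have hB : (base4N g (n + s) : ℚ) = 5 * base4 g (n + s) := by
    unfold base4N base4
    push_cast
    ring
  rw [hB] at hQ
  have hD' : (0 : ℚ) < ((g - mstar g (n + s) : ℕ) : ℚ) := by
    have : 0 < g - mstar g (n + s) := by omega
    exact_mod_cast this
  have hC : (0 : ℚ) < (g.choose 2 : ℚ) := by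
    have : 0 < g.choose 2 := Nat.choose_pos hg
    exact_mod_cast this
  have hCm : (0 : ℚ) < ((mstar g (n + s)).choose 2 : ℚ) := by
    have : 0 < (mstar g (n + s)).choose 2 := Nat.choose_pos hms2
    exact_mod_cast this
  have hmu : Lterm4 g (n + s) (mstar g (n + s)) / ((mstar g (n + s)).choose 2 : ℚ) * ((n + s).choose 2 : ℚ) =
      Lterm4 g (n + s) (mstar g (n + s)) * ((n + s).choose 2 : ℚ) / ((mstar g (n + s)).choose 2 : ℚ) := by ring
  rw [hmu, le_sub_iff_add_le, le_div_iff₀ hCm]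
  have hpos : (0 : ℚ) < 15 * ((g - mstar g (n + s) : ℕ) : ℚ) * (g.choose 2 : ℚ) := by positivity
  split_ifs at hQ ⊢ with hc <;> nlinarith [hQ, hpos]

/-- From `TPosCell`: `0 < T⁺(g,p)`. -/
theorem tpos_of_tPosCell {g p : ℕ} (hg : 2 ≤ g) (hp : 3 ≤ p) (hpg : p ≤ g) (h : TPosCell g p) : 0 < Tplus4 g p := by
  obtain ⟨hms2, hmsq⟩ := mstar_bounds (g := g) hp
  have hmsg : mstar g p < g := by omega
  unfold TPosCell at h
  unfold Tplus4 muTW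
  have hQ : (((g - mstar g p : ℕ) : ℤ) * (g.choose 2 : ℤ) * ((mstar g p).choose 2 : ℤ) * (3 * base4N g p) : ℚ) <
      ((p.choose 2 : ℤ) * LtermN4 g p (mstar g p) : ℚ) := by exact_mod_cast h
  push_cast at hQ
  rw [LtermN4_eq hmsg hg] at hQ
  have hB : (base4N g p : ℚ) = 5 * base4 g p := by
    unfold base4N base4
    push_cast
    ring
  rw [hB] at hQ
  have hD' : (0 : ℚ) < ((g - mstar g p : ℕ) : ℚ) := by
    have : 0 < g - mstar g p := by omega
    exact_mod_cast this
  have hC : (0 : ℚ) < (g.choose 2 : ℚ) := by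
    have : 0 < g.choose 2 := Nat.choose_pos hg
    exact_mod_cast this
  have hCm : (0 : ℚ) < ((mstar g p).choose 2 : ℚ) := by
    have : 0 < (mstar g p).choose 2 := Nat.choose_pos hms2
    exact_mod_cast this
  have hmu : Lterm4 g p (mstar g p) / ((mstar g p).choose 2 : ℚ) * (p.choose 2 : ℚ) =
      Lterm4 g p (mstar g p) * (p.choose 2 : ℚ) / ((mstar g p).choose 2 : ℚ) := by ring
  rw [hmu, sub_pos, lt_div_iff₀ hCm]
  have hpos : (0 : ℚ) < 15 * ((g - mstar g p : ℕ) : ℚ) * (g.choose 2 : ℚ) := by positivity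
  nlinarith [hQ, hpos]

end PercRepro.SixFour
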